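import Mathlib
import Summits.QuantumFields.YangMills.Theorems.ConvexGribovBodyContinuumLegGivenGapStubRpCoreChord
import HarnessLib

/-!
# `ContinuumFromLatticeGap` (stmt-QuantumFields-15915), line `registered` (reshape 6): `stub_chordTwoCase`

Support file for the crux item stmt-QuantumFields-15915
(`Summit.QuantumFields.YangMills.Theses.GronwallGap.ContinuumFromLatticeGap`), registered stub
`stub_chordTwoCase` of the line `registered` (reshape 6): **the two-case log-convex chord**, the elementary
real-analysis step of the decay leg (used with `g n = corr(F∘Θ, F; n)`, the reflected connected correlation on
the odd torus, which is non-negative and log-convex in `n` by reflection positivity).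

**Statement.** A non-negative sequence `g 0, …, g N` (`N > 0`) which is log-convex at every interior index
(`g n ^ 2 ≤ g (n-1) * g (n+1)`), with far value `g N ≤ D e^{-μ N}` (`D > 0`), satisfies for all `0 ≤ μ' ≤ μ`
and all `n ≤ N`: `g n ≤ e^{-μ' n} g 0 + D e^{-(μ - μ') N}`.

**Proof.** Put `E := D e^{-(μ - μ') N} > 0` and normalise by `c := max (g 0) E > 0`: the sequence `g / c` is
again non-negative and log-convex, starts below `1`, and ends below `e^{-μ' N}` because
`D e^{-μ N} = E e^{-μ' N} ≤ c e^{-μ' N}`.  The landed log-convex chord bound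
`ContinuumLegGivenGap.rpCore_chordBound` (with `B = D = 1`, rate `μ'`) gives `g n / c ≤ e^{-μ' n}`, whence
`g n ≤ c e^{-μ' n} ≤ (g 0 + E) e^{-μ' n} ≤ e^{-μ' n} g 0 + E` (`μ' ≥ 0`).  (The two cases `g 0 ≥ E` /
`g 0 < E` of the informal argument are the two values of the maximum.)

No definitions, no facts; Mathlib + the landed chord bound only. [folklore]
-/

namespace Summit.QuantumFields.YangMills.Theorems.ContinuumFromLatticeGap

open Summit.QuantumFields.YangMills.Theorems.ContinuumLegGivenGap

/-- **The two-case log-convex chord.**  A non-negative sequence on `0, …, N` (`N > 0`), log-convex at every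
interior index, with far value `g N ≤ D e^{−μN}` (`D > 0`) satisfies, for every `0 ≤ μ' ≤ μ`,
`g n ≤ e^{−μ' n} g 0 + D e^{−(μ−μ')N}` for all `n ≤ N` (normalise by `max (g 0) (D e^{−(μ−μ')N})` and apply
the log-convex chord bound `rpCore_chordBound` with `B = D = 1` at rate `μ'`). [folklore] -/
theorem stub_chordTwoCase :
    ∀ (g : ℕ → ℝ) (N : ℕ) (D μ μ' : ℝ), 0 < N → 0 < D → 0 ≤ μ' → μ' ≤ μ →
      (∀ n : ℕ, n ≤ N → 0 ≤ g n) →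
      (∀ n : ℕ, 1 ≤ n → n + 1 ≤ N → g n ^ 2 ≤ g (n - 1) * g (n + 1)) →
      g N ≤ D * Real.exp (-(μ * N)) →
      ∀ n : ℕ, n ≤ N → g n ≤ Real.exp (-(μ' * n)) * g 0 + D * Real.exp (-((μ - μ') * N)) := by
  intro g N D μ μ' hN hD hμ' _hμ hpos hlc hNb n hn
  -- the normalisation `c := max (g 0) E`, `E := D e^{-(μ-μ')N}`
  set E : ℝ := D * Real.exp (-((μ - μ') * N)) with hE
  have hE0 : 0 < E := mul_pos hD (Real.exp_pos _)
  set c : ℝ := max (g 0) E with hc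
  have hc0 : 0 < c := lt_of_lt_of_le hE0 (le_max_right _ _)
  -- the normalised sequence `fun m => g m / c` is non-negative, log-convex, starts below `1`
  have hpos' : ∀ m : ℕ, m ≤ N → 0 ≤ g m / c := fun m hm => div_nonneg (hpos m hm) hc0.le
  have hlc' : ∀ m : ℕ, 1 ≤ m → m + 1 ≤ N → (g m / c) ^ 2 ≤ g (m - 1) / c * (g (m + 1) / c) := by
    intro m h1 h2
    rw [div_pow, div_mul_div_comm, ← sq]
    exact div_le_div_of_nonneg_right (hlc m h1 h2) (sq_nonneg c)
  have h0' : g 0 / c ≤ 1 := (div_le_one₀ hc0).2 (le_max_left _ _)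
  -- and ends below `e^{-μ' N}`
  have hfar : D * Real.exp (-(μ * N)) = E * Real.exp (-(μ' * N)) := by
    rw [hE, mul_assoc, ← Real.exp_add]
    congr 1
    ring
  have hN' : g N / c ≤ 1 * Real.exp (-(μ' * N)) := by
    rw [one_mul, div_le_iff₀ hc0]
    calc g N ≤ D * Real.exp (-(μ * N)) := hNb
      _ = E * Real.exp (-(μ' * N)) := hfar
      _ ≤ c * Real.exp (-(μ' * N)) := by gcongr; exact le_max_right _ _
      _ = Real.exp (-(μ' * N)) * c := mul_comm _ _
  -- the chord bound for the normalised sequence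
  have hchord := rpCore_chordBound (fun m => g m / c) N 1 1 μ' hN le_rfl le_rfl hpos' hlc' h0' hN' n hn
  simp only [Real.log_one, zero_div, zero_mul, add_zero, one_mul] at hchord
  rw [div_le_iff₀ hc0] at hchord
  -- back to `g`
  have hexp1 : Real.exp (-(μ' * n)) ≤ 1 := by
    rw [Real.exp_le_one_iff]
    have : 0 ≤ μ' * n := mul_nonneg hμ' (Nat.cast_nonneg n)
    linarith
  have hcle : c ≤ g 0 + E := max_le_add_of_nonneg (hpos 0 (Nat.zero_le _)) hE0.le
  calc g n ≤ Real.exp (-(μ' * n)) * c := hchord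
    _ ≤ Real.exp (-(μ' * n)) * (g 0 + E) := by gcongr
    _ = Real.exp (-(μ' * n)) * g 0 + Real.exp (-(μ' * n)) * E := mul_add _ _ _
    _ ≤ Real.exp (-(μ' * n)) * g 0 + 1 * E := by gcongr
    _ = Real.exp (-(μ' * n)) * g 0 + E := by rw [one_mul]

end Summit.QuantumFields.YangMills.Theorems.ContinuumFromLatticeGap
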